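import Summits.BirchSwinnertonDyer.BirchSwinnertonDyer.Theorems.EisensteinPrimesBSDpOnCellCTelescopeK2WeightTwoControlMapOfFrobenius
import Summits.BirchSwinnertonDyer.BirchSwinnertonDyer.Theorems.EisensteinPrimesBSDpOnCellCTelescopeK2FrobeniusAnnihilatorOfFibre
import HarnessLib

/-!
# Crux 4 `BSDpOnCellC` (stmt-BirchSwinnertonDyer-19034), line «telescope» v10, leaf N2|pub sub-leaf W2 ON THE SPLIT MULTIPLICATIVE BRANCH:
# x2-p2 g19's weight-two control map (p752662) WITH ITS (ann) INPUT DISCHARGED — W2's `∃α` from N1's fibre data + Heegner + (split) alone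
# (successor LEAD `cruxlead-19034` g3; `--supports`, helper; THEOREMS ONLY; closes no registered stub)

HONEST FRAMING. No registered stub, no crux, no summit statement is proved; BSD is proved for no curve. `exists_weightTwoControlMap_of_fibreData_of_heegner`
is width x2-p2 g19's `TelescopeK2WeightTwoControlMapOfFrobenius.exists_weightTwoControlMap_of_frobenius_of_heegner` (p752662) with the binder
(ann) REMOVED (discharged by `TelescopeK2FrobeniusAnnihilatorOfFibre.frobeniusAnnihilator_of_fibreData`) and ONE binder ADDED: the finite
COKERNEL of `θ₀` (`hcoker`, part of N1's (fd₀) in the registered texts). All other binders are x2-p2's, token for token (extracted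
programmatically from the tree file). What W2 still needs beyond FD-shapes on Cell C: (split) — `W.HasSplitMultiplicativeReductionAtPrime p`
(the non-split twin of bsd-stepL's Tate chain (L1) is not in the tree) — and the Heegner data `N₀`, `hHeeg`, `hS₀N` (available in W2's prefix).

References: Jetchev–Skinner–Wan, Camb. J. Math. 5 (2017) §3.4 [JetchevSkinnerWan2017]; F. Castella, Math. Ann. (2018) erratum, Lemma 2.1
[Castella2018Erratum]; R. Greenberg, Doc. Math. Extra Vol. (2006) §3 A [Greenberg2006]; D. Brink, Math. Comp. 76 (2007) [Brink2007].
-/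

noncomputable section

-- D-0017: single-problem summit, the namespace repeats the problem name by design.
set_option linter.dupNamespace false
set_option autoImplicit false

open Field IsDedekindDomain NumberField WeierstrassCurve
open Literature.NumberTheory.GaloisRepresentations Literature.NumberTheory.EllipticCurves
  Literature.NumberTheory.EllipticCurves.BigRepModule Literature.NumberTheory.EllipticCurves.BigGaloisRep
open Summit.BirchSwinnertonDyer.Rank1Residual.X11b

namespace Summit.BirchSwinnertonDyer.BirchSwinnertonDyer.Theorems.TelescopeK2WeightTwoControlMapOfFibreData

open Summit.BirchSwinnertonDyer.BirchSwinnertonDyer.Theorems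

/-- **W2's weight-two control map on the split multiplicative branch, (ann)-free.** x2-p2 g19's
`exists_weightTwoControlMap_of_frobenius_of_heegner` with the Frobenius-annihilator input supplied by
`TelescopeK2FrobeniusAnnihilatorOfFibre.frobeniusAnnihilator_of_fibreData` (which consumes the finite cokernel of `θ₀`).
[cite: JetchevSkinnerWan2017, §3.4, Lemma 3.4.1] [cite: Castella2018Erratum, Lemma 2.1] [cite: Greenberg2006, §3 A] [cite: Brink2007, Cor. 1] -/
theorem exists_weightTwoControlMap_of_fibreData_of_heegner {K : Type} [Field K] [NumberField K] {p : ℕ} [Fact p.Prime]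
    (W : WeierstrassCurve ℚ) [W.IsElliptic] (hK : IsImaginaryQuadratic K) (hp2 : p ≠ 2)
    (hsplit : W.HasSplitMultiplicativeReductionAtPrime p)
    (κ : ZpExtension K p) (hκ : κ.IsAnticyclotomic)
    (𝔭bar : HeightOneSpectrum (𝓞 K)) (h𝔭bar : ((p : ℕ) : 𝓞 K) ∈ 𝔭bar.asIdeal)
    (he : 𝔭bar.asIdeal.ramificationIdx (𝓞 ℚ) = 1) (hf : 𝔭bar.asIdeal.inertiaDeg (𝓞 ℚ) = 1)
    [TopologicalSpace (PowerSeries ℤ_[p])] (A₂ : Type) [AddCommGroup A₂] [Module (PowerSeries ℤ_[p]) A₂]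
    [TopologicalSpace A₂] [DiscreteTopology A₂]
    (ρ₂ : ContinuousRep (absoluteGaloisGroup K) (PowerSeries ℤ_[p]) A₂)
    [TopologicalSpace (PowerSeries (PowerSeries ℤ_[p]))]
    [ContinuousSMul (PowerSeries (PowerSeries ℤ_[p])) (BigRepModule (PowerSeries ℤ_[p]) p A₂)]
    (htor : ∀ a : A₂, ∃ n : ℕ, (PowerSeries.X : PowerSeries ℤ_[p]) ^ n • a = 0)
    (hcof : ∀ a : A₂, ∃ b : A₂, (PowerSeries.X : PowerSeries ℤ_[p]) • b = a)
    (S₀ : Finset (HeightOneSpectrum (𝓞 K))) (hunr : GaloisRep.IsUnramifiedOutside (S₀ : Set (HeightOneSpectrum (𝓞 K))) ρ₂)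
    (θ₀ : Submodule.torsionBy (PowerSeries ℤ_[p]) A₂ (PowerSeries.X : PowerSeries ℤ_[p]) →+
      PrimaryTorsion (W.baseChange K).geomPoints p)
    (hθσ : ∀ (σ : absoluteGaloisGroup K)
      (a : Submodule.torsionBy (PowerSeries ℤ_[p]) A₂ (PowerSeries.X : PowerSeries ℤ_[p])),
      θ₀ (BigGaloisRep.torsionRep ρ₂ (PowerSeries.X : PowerSeries ℤ_[p]) σ a) =
        (W.baseChange K).primaryTorsionGaloisRep p σ (θ₀ a))
    (hker : Finite θ₀.ker) (hcoker : Finite (PrimaryTorsion (W.baseChange K).geomPoints p ⧸ θ₀.range))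
    -- Heegner: `K` satisfies the Heegner hypothesis for `N₀ ≠ 0` and the bad primes away from `p` divide `N₀`
    {N₀ : ℕ} (hN0 : N₀ ≠ 0) (hHeeg : SatisfiesHeegnerHypothesis N₀ K)
    (hS₀N : ∀ w ∈ S₀, ((p : ℕ) : 𝓞 K) ∉ w.asIdeal → ((N₀ : ℕ) : 𝓞 K) ∈ w.asIdeal) :
    ∃ α : QuotSMulTop (PowerSeries.C (PowerSeries.X : PowerSeries ℤ_[p])) (XBig κ ρ₂ 𝔭bar (∅ : Set (HeightOneSpectrum (𝓞 K))))
        →ₗ[PowerSeries (PowerSeries ℤ_[p])]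
        CharacterModule (TorsionControl.selmer (localMap K) (strictSet p 𝔭bar (∅ : Set (HeightOneSpectrum (𝓞 K))))
          (TorsionControl.torsionRep (AnticyclotomicBigGaloisRep κ ρ₂) (PowerSeries.C (PowerSeries.X : PowerSeries ℤ_[p])))),
      (∀ m ∈ LinearMap.ker α, ∃ s : PowerSeries (PowerSeries ℤ_[p]),
        ¬ ((PowerSeries.C (PowerSeries.X : PowerSeries ℤ_[p])) ∣ s) ∧ s • m = 0) ∧
      Finite ((CharacterModule (TorsionControl.selmer (localMap K) (strictSet p 𝔭bar (∅ : Set (HeightOneSpectrum (𝓞 K))))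
        (TorsionControl.torsionRep (AnticyclotomicBigGaloisRep κ ρ₂) (PowerSeries.C (PowerSeries.X : PowerSeries ℤ_[p]))))) ⧸
          LinearMap.range α) :=
  TelescopeK2WeightTwoControlMapOfFrobenius.exists_weightTwoControlMap_of_frobenius_of_heegner W hK hp2 hsplit κ hκ 𝔭bar h𝔭bar
    he hf A₂ ρ₂ htor hcof S₀ hunr θ₀ hθσ hker hN0 hHeeg hS₀N fun w _ hpw d =>
      TelescopeK2FrobeniusAnnihilatorOfFibre.frobeniusAnnihilator_of_fibreData (W.baseChange K) ρ₂ hcof θ₀ hθσ hker hcoker w hpw d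

end Summit.BirchSwinnertonDyer.BirchSwinnertonDyer.Theorems.TelescopeK2WeightTwoControlMapOfFibreData

end
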